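/- Width seat `ym-line-sll-p2` (prover-ym-line-sll-p2-g0-0), route `SoftLoopLongLag`, crux T′ `ColdBoxSoftLoopLagFloor` (stmt-QuantumFields-22503),
line `birth` (skeleton `Cruxes/ColdBoxSoftLoopLagFloor/Lines/birth.lean`, v1), registered stub S1 `stub_gaussCore`; lead ym-line-sll-p1. -/
import Summits.QuantumFields.YangMills.Theorems.SoftLoopLongLagDefs
import Literature.Probability.LatticeModels.LatticeGreenAsymptotics

/-!
# Registered stub S1 `stub_gaussCore` of crux T′ `ColdBoxSoftLoopLagFloor` (stmt-QuantumFields-22503), BY NAME + SIGNATURE: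
# the Wick floor `c·R³ ≤ wickLagSum R R` of the free lattice-Maxwell square–square inductance on `ℤ⁴`

HONEST LABEL.  Route `SoftLoopLongLag` serves the RECORD-label rung R2xi-G of LADDER-YM (leaf `WeakCouplingRates.XiPow`: an UPPER
bound `m ≤ β^{-ε}` on the lattice mass gap, every compact simple `G`).  This file is `G`-free, `β`-free lattice magnetostatics; it is
NOT a statement about the Clay/Yang–Mills mass gap and touches no summit statement.

WHAT (all proved, standard axioms, no `def`, no named fact; objects `rectSurface`, `mutualInductance`, `timeZeroCube`, `wickLagSum`
from `Theorems/SoftLoopLongLagDefs.lean`, kernel `curvatureTwoPoint = d(−Δ)⁻¹d*` / `edgeGreen = [dir = dir']·latticeGreen/2` from the tree):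
* §1 `sum_rectSurface_plaquetteCurl` — DISCRETE STOKES on the `R × T` rectangle: `Σ_{p ∈ S} (dA)_p` = oriented boundary sum of `A`.
* §2 `mutualInductance_eq_boundary` — the NEUMANN FORM: applying Stokes in both squares (`curvatureTwoPoint_eq_plaquetteCurl`),
  `M(x, y; R)` is the double sum of `edgeGreen` over pairs of PARALLEL boundary sides; only `latticeGreen` of side-to-side displacement
  vectors remains (`Σ_{a,a'<R} [2G₀(z+(a−a')e₁) − G₀(z+(a−a')e₁−Re₂) − G₀(z+(a−a')e₁+Re₂)] + (1 ↔ 2)`, `z = x − y`, `G₀ = latticeGreen/2`).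
* §3 `latticeGreen_step_lower` — from the tree's `latticeGreen_asymptotics` (Lawler–Limic 2010 Thm 4.3.1, `d = 4`:
  `G(x) = a|x|⁻² + O(|x|⁻⁴)`, `a = Γ(1)/(2π²) > 0`): there are `δ > 0`, `R₀` with `G(w) − G(w') ≥ δ/R²` whenever `|w|² = R² + t`,
  `|w'|² = 2R² + t`, `0 ≤ t ≤ R²`, `R ≥ R₀` (leading term `aR²/(|w|²|w'|²) ≥ a/(6R²)`, errors `≤ 2K/R⁴`; `δ = a/12`).
* §4 `mutualInductance_diag_lower` — the time-coaxial inductance `m(R) = M(x, x + R e₀; R)` (two parallel `R×R` squares displaced by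
  `R` perpendicular to their plane) is `≥ 2δ > 0` for `R ≥ R₀`: in the Neumann form with `z = −R e₀` every side pair contributes
  `½[(G v − G(v − Re₂)) + (G v − G(v + Re₂))] ≥ δ/R²`, `v = (a−a')e₁ − Re₀`, and there are `R²` pairs per direction.
  `pow_three_le_card_timeZeroCube` — `|timeZeroCube R| ≥ R³`.
* **`stub_gaussCore`** — `∃ c > 0, ∃ R₀, ∀ R ≥ R₀, c·R³ ≤ wickLagSum R R`: keep the diagonal pairs `x' = x` (all terms are squares),
  each `≥ m₀²`, `c = m₀²` — exactly the registered signature, against the tree objects of the v1 skeleton.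

References: G. F. Lawler, V. Limic, *Random Walk: A Modern Introduction* (2010), Thm 4.3.1 (tree `latticeGreen_asymptotics`);
C. Garban, A. Sepúlveda, IMRN 2023 §2.3.3/§4 (tree `curvatureTwoPoint`); Neumann's double-line formula for mutual inductance (folklore).
-/

set_option autoImplicit false

noncomputable section

open Finset
open Literature.Probability.LatticeModels
open Literature.MathematicalPhysics.QuantumFieldTheory (curvatureTwoPoint edgeGreen plaquetteCurl plaquetteCurl_eq
  curvatureTwoPoint_eq_plaquetteCurl edgeGreen_apply)
open Literature.MathematicalPhysics.QuantumLattice (ZdEdge ZdPlaquette)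

namespace Summit.QuantumFields.YangMills.Theorems.SoftLoopLongLag

/-! ## §1 Discrete Stokes on the spanning surface of a rectangle -/

/-- Sums over the spanning surface `rectSurface x R T` are sums over the parameter rectangle `[0, R) × [0, T)`
(the parametrisation `(a, b) ↦ (x + a e₁ + b e₂; 1, 2)` is injective). -/
theorem sum_rectSurface_eq (x : Site 4) (R T : ℕ) (f : ZdPlaquette 4 → ℝ) :
    ∑ p ∈ rectSurface x R T, f p = ∑ a ∈ range R, ∑ b ∈ range T,
      f ((x + Pi.single 1 (a : ℤ) + Pi.single 2 (b : ℤ), ⟨((1 : Fin 4), (2 : Fin 4)), by decide⟩) : ZdPlaquette 4) := by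
  unfold rectSurface
  rw [sum_image, sum_product]
  rintro ⟨a, b⟩ _ ⟨a', b'⟩ _ h
  simp only [Prod.mk.injEq] at h
  obtain ⟨h1, _⟩ := h
  have e1 := congr_fun h1 1
  have e2 := congr_fun h1 2
  simp at e1 e2
  exact Prod.ext (by exact_mod_cast e1) (by exact_mod_cast e2)

/-- **Discrete Stokes on a rectangle.**  The total lattice curl `Σ_{p ∈ S} (dA)_p` of a `1`-cochain `A` over the spanning surface
of the `R × T` rectangle at `x` in the `(1,2)` plane is the oriented boundary sum of `A`: bottom minus top sides (direction `1`),
right minus left sides (direction `2`); interior edges cancel in pairs (two telescoping sums). -/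
theorem sum_rectSurface_plaquetteCurl (A : ZdEdge 4 → ℝ) (x : Site 4) (R T : ℕ) :
    ∑ p ∈ rectSurface x R T, plaquetteCurl A p =
      ∑ a ∈ range R, (A (x + Pi.single 1 (a : ℤ), 1) - A (x + Pi.single 1 (a : ℤ) + Pi.single 2 (T : ℤ), 1)) +
      ∑ b ∈ range T, (A (x + Pi.single 1 (R : ℤ) + Pi.single 2 (b : ℤ), 2) - A (x + Pi.single 2 (b : ℤ), 2)) := by
  rw [sum_rectSurface_eq]
  simp only [plaquetteCurl_eq]
  have hsplit : ∀ a b : ℕ,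
      A (x + Pi.single 1 (a : ℤ) + Pi.single 2 (b : ℤ), 1) +
        A (x + Pi.single 1 (a : ℤ) + Pi.single 2 (b : ℤ) + Pi.single 1 1, 2) -
        A (x + Pi.single 1 (a : ℤ) + Pi.single 2 (b : ℤ) + Pi.single 2 1, 1) -
        A (x + Pi.single 1 (a : ℤ) + Pi.single 2 (b : ℤ), 2) =
      (A (x + Pi.single 1 (a : ℤ) + Pi.single 2 (b : ℤ), 1) -
        A (x + Pi.single 1 (a : ℤ) + Pi.single 2 ((b + 1 : ℕ) : ℤ), 1)) +
      (A (x + Pi.single 1 ((a + 1 : ℕ) : ℤ) + Pi.single 2 (b : ℤ), 2) -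
        A (x + Pi.single 1 (a : ℤ) + Pi.single 2 (b : ℤ), 2)) := by
    intro a b
    have h2 : x + Pi.single 1 (a : ℤ) + Pi.single 2 (b : ℤ) + Pi.single 2 1 =
        x + Pi.single 1 (a : ℤ) + Pi.single 2 ((b + 1 : ℕ) : ℤ) := by
      rw [add_assoc, ← Pi.single_add]; push_cast; rfl
    have h1 : x + Pi.single 1 (a : ℤ) + Pi.single 2 (b : ℤ) + Pi.single 1 1 =
        x + Pi.single 1 ((a + 1 : ℕ) : ℤ) + Pi.single 2 (b : ℤ) := by
      rw [add_right_comm, add_assoc x, ← Pi.single_add]; push_cast; rfl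
    rw [h1, h2]; ring
  simp only [hsplit, sum_add_distrib]
  congr 1
  · refine sum_congr rfl fun a _ => ?_
    have h := Finset.sum_range_sub' (fun b : ℕ => A (x + Pi.single 1 (a : ℤ) + Pi.single 2 (b : ℤ), (1 : Fin 4))) T
    simp only [Nat.cast_zero, Pi.single_zero, add_zero] at h
    exact h
  · rw [sum_comm]
    refine sum_congr rfl fun b _ => ?_
    have h := Finset.sum_range_sub (fun a : ℕ => A (x + Pi.single 1 (a : ℤ) + Pi.single 2 (b : ℤ), (2 : Fin 4))) R
    simp only [Nat.cast_zero, Pi.single_zero, add_zero] at h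
    exact h

/-! ## §2 The Neumann (boundary) form of the square–square inductance -/

/-- The lattice curl is additive in the `1`-cochain: finite sums pass through `plaquetteCurl`. -/
theorem sum_plaquetteCurl {ι : Type*} (s : Finset ι) (B : ι → ZdEdge 4 → ℝ) (p : ZdPlaquette 4) :
    ∑ i ∈ s, plaquetteCurl (B i) p = plaquetteCurl (fun e => ∑ i ∈ s, B i e) p := by
  simp only [plaquetteCurl, Finset.mul_sum]
  rw [Finset.sum_comm]

/-- Inner Stokes against an edge of direction `1`: only the two direction-`1` sides of the second square see the edge Green kernel
(`edgeGreen` vanishes between edges of different directions). -/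
theorem sum_rectSurface_plaquetteCurl_edgeGreen_one (u y : Site 4) (R : ℕ) :
    ∑ q ∈ rectSurface y R R, plaquetteCurl (fun f => edgeGreen (u, (1 : Fin 4)) f) q =
      ∑ a' ∈ range R, (latticeGreen (u - (y + Pi.single 1 (a' : ℤ))) / 2 -
        latticeGreen (u - (y + Pi.single 1 (a' : ℤ) + Pi.single 2 (R : ℤ))) / 2) := by
  rw [sum_rectSurface_plaquetteCurl]
  simp [edgeGreen_apply]

/-- Inner Stokes against an edge of direction `2`: only the two direction-`2` sides of the second square contribute. -/
theorem sum_rectSurface_plaquetteCurl_edgeGreen_two (u y : Site 4) (R : ℕ) :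
    ∑ q ∈ rectSurface y R R, plaquetteCurl (fun f => edgeGreen (u, (2 : Fin 4)) f) q =
      ∑ b' ∈ range R, (latticeGreen (u - (y + Pi.single 1 (R : ℤ) + Pi.single 2 (b' : ℤ))) / 2 -
        latticeGreen (u - (y + Pi.single 2 (b' : ℤ))) / 2) := by
  rw [sum_rectSurface_plaquetteCurl]
  simp [edgeGreen_apply]

/-- **Neumann form of the mutual inductance** (double discrete Stokes).  The flux–flux covariance of the `R×R` squares at `x` and
`y` is the double boundary sum of the edge Green kernel over pairs of PARALLEL sides: direction-`1` sides `{x + a e₁ (+), x + a e₁ + R e₂ (−)}`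
against `{y + a' e₁ (+), y + a' e₁ + R e₂ (−)}`, and direction-`2` sides `{x + R e₁ + b e₂ (+), x + b e₂ (−)}` against
`{y + R e₁ + b' e₂ (+), y + b' e₂ (−)}`, each pair weighted by `latticeGreen(side − side')/2`. -/
theorem mutualInductance_eq_boundary (x y : Site 4) (R : ℕ) :
    mutualInductance x y R =
      ∑ a ∈ range R, ∑ a' ∈ range R,
        ((latticeGreen (x + Pi.single 1 (a : ℤ) - (y + Pi.single 1 (a' : ℤ))) / 2 -
          latticeGreen (x + Pi.single 1 (a : ℤ) - (y + Pi.single 1 (a' : ℤ) + Pi.single 2 (R : ℤ))) / 2) -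
         (latticeGreen (x + Pi.single 1 (a : ℤ) + Pi.single 2 (R : ℤ) - (y + Pi.single 1 (a' : ℤ))) / 2 -
          latticeGreen (x + Pi.single 1 (a : ℤ) + Pi.single 2 (R : ℤ) - (y + Pi.single 1 (a' : ℤ) + Pi.single 2 (R : ℤ))) / 2)) +
      ∑ b ∈ range R, ∑ b' ∈ range R,
        ((latticeGreen (x + Pi.single 1 (R : ℤ) + Pi.single 2 (b : ℤ) - (y + Pi.single 1 (R : ℤ) + Pi.single 2 (b' : ℤ))) / 2 -
          latticeGreen (x + Pi.single 1 (R : ℤ) + Pi.single 2 (b : ℤ) - (y + Pi.single 2 (b' : ℤ))) / 2) -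
         (latticeGreen (x + Pi.single 2 (b : ℤ) - (y + Pi.single 1 (R : ℤ) + Pi.single 2 (b' : ℤ))) / 2 -
          latticeGreen (x + Pi.single 2 (b : ℤ) - (y + Pi.single 2 (b' : ℤ))) / 2)) := by
  have step1 : mutualInductance x y R =
      ∑ p ∈ rectSurface x R R, plaquetteCurl
        (fun e => ∑ q ∈ rectSurface y R R, plaquetteCurl (fun f => edgeGreen e f) q) p := by
    unfold mutualInductance
    refine sum_congr rfl fun p _ => ?_
    simp_rw [curvatureTwoPoint_eq_plaquetteCurl]
    exact sum_plaquetteCurl _ _ _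
  rw [step1, sum_rectSurface_plaquetteCurl]
  simp only [sum_rectSurface_plaquetteCurl_edgeGreen_one, sum_rectSurface_plaquetteCurl_edgeGreen_two,
    ← sum_sub_distrib]

/-! ## §3 The Green-function step at scale `R` (from `latticeGreen_asymptotics`, `d = 4`) -/

/-- **`d = 4` asymptotics of the lattice Green function** in the form used here: `G(x) = a/|x|² + O(|x|⁻⁴)` with `a > 0`. -/
theorem latticeGreen_asymptotics_four : ∃ a K : ℝ, 0 < a ∧ 0 ≤ K ∧ ∀ x : Site 4, x ≠ 0 →
    |latticeGreen x - a / (∑ i, ((x i : ℤ) : ℝ) ^ 2)| ≤ K / (∑ i, ((x i : ℤ) : ℝ) ^ 2) ^ 2 := by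
  obtain ⟨K, hK⟩ := latticeGreen_asymptotics (d := 4) (by norm_num)
  refine ⟨Real.Gamma ((4 : ℝ) / 2 - 1) / (2 * Real.pi ^ ((4 : ℝ) / 2)), max K 0, ?_, le_max_right _ _, fun x hx => ?_⟩
  · have hΓ : 0 < Real.Gamma ((4 : ℝ) / 2 - 1) := Real.Gamma_pos_of_pos (by norm_num)
    positivity
  have h := hK x hx
  simp only [Nat.cast_ofNat] at h
  set S : ℝ := ∑ i, ((x i : ℤ) : ℝ) ^ 2 with hSdef
  have hS1 : 1 ≤ S := one_le_sum_sq_of_ne_zero hx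
  have hS0 : 0 < S := by linarith
  have h1 : Real.sqrt S ^ ((2 : ℝ) - 4) = 1 / S := by
    rw [show (2 : ℝ) - 4 = -2 by norm_num, Real.rpow_neg (Real.sqrt_nonneg _), Real.rpow_two,
      Real.sq_sqrt hS0.le, one_div]
  have h2 : Real.sqrt S ^ (-(4 : ℝ)) = 1 / S ^ 2 := by
    rw [Real.rpow_neg (Real.sqrt_nonneg _), show (4 : ℝ) = ((4 : ℕ) : ℝ) by norm_num, Real.rpow_natCast,
      show Real.sqrt S ^ 4 = (Real.sqrt S ^ 2) ^ 2 by ring, Real.sq_sqrt hS0.le, one_div]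
  rw [h1, h2] at h
  calc |latticeGreen x - Real.Gamma (4 / 2 - 1) / (2 * Real.pi ^ ((4 : ℝ) / 2)) / S|
      = |latticeGreen x - Real.Gamma (4 / 2 - 1) / (2 * Real.pi ^ ((4 : ℝ) / 2)) * (1 / S)| := by
        rw [mul_one_div]
    _ ≤ K * (1 / S ^ 2) := h
    _ ≤ max K 0 * (1 / S ^ 2) := mul_le_mul_of_nonneg_right (le_max_left _ _) (by positivity)
    _ = max K 0 / S ^ 2 := mul_one_div _ _

/-- **The monotonicity step of the Green function at scale `R`.** There are `δ > 0` and `R₀ ≥ 1` such that for `R ≥ R₀`,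
whenever `|w|² = R² + t` and `|w'|² = 2R² + t` with `0 ≤ t ≤ R²`, `G(w) − G(w') ≥ δ/R²` (leading term
`a(|w|⁻² − |w'|⁻²) ≥ a/(6R²)`, errors `O(R⁻⁴)`). -/
theorem latticeGreen_step_lower : ∃ δ : ℝ, 0 < δ ∧ ∃ R₀ : ℕ, 1 ≤ R₀ ∧ ∀ R : ℕ, R₀ ≤ R →
    ∀ (w w' : Site 4) (t : ℝ), 0 ≤ t → t ≤ (R : ℝ) ^ 2 →
      ∑ i, ((w i : ℤ) : ℝ) ^ 2 = (R : ℝ) ^ 2 + t → ∑ i, ((w' i : ℤ) : ℝ) ^ 2 = 2 * (R : ℝ) ^ 2 + t →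
      δ / (R : ℝ) ^ 2 ≤ latticeGreen w - latticeGreen w' := by
  obtain ⟨a, K, ha, hK, hG⟩ := latticeGreen_asymptotics_four
  refine ⟨a / 12, by positivity, ⌈24 * K / a⌉₊ + 1, Nat.le_add_left _ _, fun R hR w w' t ht0 htR hw hw' => ?_⟩
  have hR1 : (1 : ℝ) ≤ R := by exact_mod_cast (Nat.le_add_left 1 _).trans hR
  have hRK : 24 * K / a ≤ (R : ℝ) := by
    have h1 : (24 * K / a : ℝ) ≤ (⌈24 * K / a⌉₊ : ℝ) := Nat.le_ceil _
    have h2 : ((⌈24 * K / a⌉₊ : ℕ) : ℝ) + 1 ≤ (R : ℝ) := by exact_mod_cast hR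
    linarith
  set r : ℝ := (R : ℝ) ^ 2 with hr
  have hr1 : 1 ≤ r := by nlinarith
  have hr0 : 0 < r := by linarith
  have h24 : 24 * K ≤ a * r := by
    have h1 : 24 * K ≤ a * R := by
      have := (div_le_iff₀ ha).1 hRK
      linarith
    have h2 : a * (R : ℝ) ≤ a * r := by
      have : (R : ℝ) ≤ r := by nlinarith
      exact mul_le_mul_of_nonneg_left this ha.le
    linarith
  set S : ℝ := ∑ i, ((w i : ℤ) : ℝ) ^ 2 with hS
  set S' : ℝ := ∑ i, ((w' i : ℤ) : ℝ) ^ 2 with hS'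
  have hS0 : 0 < S := by rw [hw]; positivity
  have hS'0 : 0 < S' := by rw [hw']; positivity
  have hw0 : w ≠ 0 := by
    rintro rfl; have : S = 0 := (by simp [hS]); linarith
  have hw'0 : w' ≠ 0 := by
    rintro rfl; have : S' = 0 := (by simp [hS']); linarith
  have h1 := abs_le.1 (hG w hw0)
  have h2 := abs_le.1 (hG w' hw'0)
  -- leading term
  have hlead : a / (6 * r) ≤ a / S - a / S' := by
    have hSS' : S * S' ≤ 6 * r * r := by
      have hS2 : S ≤ 2 * r := by rw [hw]; linarith
      have hS'3 : S' ≤ 3 * r := by rw [hw']; linarith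
      calc S * S' ≤ 2 * r * (3 * r) := mul_le_mul hS2 hS'3 hS'0.le (by positivity)
        _ = 6 * r * r := by ring
    have hdiff : a / S - a / S' = a * r / (S * S') := by
      rw [div_sub_div _ _ hS0.ne' hS'0.ne']
      congr 1
      rw [hw, hw']; ring
    rw [hdiff, show a / (6 * r) = a * r / (6 * r * r) by field_simp]
    exact div_le_div_of_nonneg_left (by positivity) (by positivity) hSS'
  -- error terms
  have herr : K / S ^ 2 ≤ K / r ^ 2 := by
    refine div_le_div_of_nonneg_left hK (by positivity) ?_
    have : r ≤ S := by rw [hw]; linarith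
    exact pow_le_pow_left₀ hr0.le this 2
  have herr' : K / S' ^ 2 ≤ K / r ^ 2 := by
    refine div_le_div_of_nonneg_left hK (by positivity) ?_
    have : r ≤ S' := by rw [hw']; linarith
    exact pow_le_pow_left₀ hr0.le this 2
  have hsmall : 2 * (K / r ^ 2) ≤ a / (12 * r) := by
    rw [← mul_div_assoc, div_le_div_iff₀ (by positivity) (by positivity)]
    nlinarith [mul_le_mul_of_nonneg_right h24 hr0.le]
  have hsix : a / (6 * r) = 2 * (a / (12 * r)) := by
    field_simp; ring
  have htarget : a / 12 / r = a / (12 * r) := by rw [div_div]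
  rw [htarget]
  linarith [h1.1, h2.2]

/-! ## §4 The time-coaxial inductance floor and the Wick floor -/

/-- Coordinates sum of squares, shape `a eᵢ − a' eᵢ − R e₀` (`i ∈ {1, 2}`): `= R² + (a − a')²`. -/
theorem sum_sq_shape_one (i : Fin 4) (hi : i = 1 ∨ i = 2) (a a' R : ℕ) :
    ∑ j, (((Pi.single i (a : ℤ) - Pi.single i (a' : ℤ) - Pi.single 0 (R : ℤ) : Site 4) j : ℤ) : ℝ) ^ 2 =
      (R : ℝ) ^ 2 + ((a : ℝ) - a') ^ 2 := by
  rcases hi with rfl | rfl <;>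
  · simp only [Fin.sum_univ_four, Pi.sub_apply, Pi.single_apply, Fin.isValue, Fin.reduceEq, ↓reduceIte]
    push_cast
    ring

/-- Coordinates sum of squares, shape `a eᵢ − a' eᵢ − R e₀ ± R eⱼ` (`{i, j} = {1, 2}`): `= 2R² + (a − a')²`. -/
theorem sum_sq_shape_two (i j : Fin 4) (hij : (i = 1 ∧ j = 2) ∨ (i = 2 ∧ j = 1)) (a a' R : ℕ) (s : ℤ)
    (hs : s = 1 ∨ s = -1) :
    ∑ k, (((Pi.single i (a : ℤ) - Pi.single i (a' : ℤ) - Pi.single 0 (R : ℤ) + s • Pi.single j (R : ℤ) : Site 4) k : ℤ) : ℝ) ^ 2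
      = 2 * (R : ℝ) ^ 2 + ((a : ℝ) - a') ^ 2 := by
  rcases hij with ⟨rfl, rfl⟩ | ⟨rfl, rfl⟩ <;> rcases hs with rfl | rfl <;>
  · simp only [Fin.sum_univ_four, Pi.sub_apply, Pi.add_apply, Pi.smul_apply, smul_eq_mul, Pi.single_apply, Fin.isValue,
      Fin.reduceEq, ↓reduceIte]
    push_cast
    ring

/-- In the parameter square `a, a' ∈ [0, R)`, the offset obeys `(a − a')² ≤ R²`. -/
theorem sq_sub_le_sq_of_mem_range {R a a' : ℕ} (ha : a ∈ range R) (ha' : a' ∈ range R) :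
    ((a : ℝ) - a') ^ 2 ≤ (R : ℝ) ^ 2 := by
  have h1 : (a : ℝ) < R := by exact_mod_cast mem_range.1 ha
  have h2 : (a' : ℝ) < R := by exact_mod_cast mem_range.1 ha'
  have h3 : (0 : ℝ) ≤ a := Nat.cast_nonneg a
  have h4 : (0 : ℝ) ≤ a' := Nat.cast_nonneg a'
  nlinarith [mul_pos (show (0 : ℝ) < R - (a - a') by linarith) (show (0 : ℝ) < R + (a - a') by linarith)]

/-- **The time-coaxial square–square inductance is bounded below**: there are `m₀ > 0` and `R₀` with
`m(R) = M(x, x + R e₀; R) ≥ m₀` for all `R ≥ R₀` and all base points `x` (Neumann form + the monotonicity step). -/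
theorem mutualInductance_diag_lower : ∃ m₀ : ℝ, 0 < m₀ ∧ ∃ R₀ : ℕ, 1 ≤ R₀ ∧ ∀ R : ℕ, R₀ ≤ R → ∀ x : Site 4,
    m₀ ≤ mutualInductance x (x + Pi.single 0 (R : ℤ)) R := by
  obtain ⟨δ, hδ, R₀, hR₀, hstep⟩ := latticeGreen_step_lower
  refine ⟨δ + δ, by positivity, R₀, hR₀, fun R hR x => ?_⟩
  have hR1 : (1 : ℝ) ≤ R := by exact_mod_cast hR₀.trans hR
  have hRne : (R : ℝ) ^ 2 ≠ 0 := by positivity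
  have hconst : ∑ _a ∈ range R, ∑ _a' ∈ range R, δ / (R : ℝ) ^ 2 = δ := by
    simp only [sum_const, card_range, nsmul_eq_mul]
    field_simp
  rw [mutualInductance_eq_boundary]
  refine add_le_add ?_ ?_
  · rw [← hconst]
    refine sum_le_sum fun a ha => sum_le_sum fun a' ha' => ?_
    have e1 : (x + Pi.single 1 (a : ℤ) - (x + Pi.single 0 (R : ℤ) + Pi.single 1 (a' : ℤ)) : Site 4) =
        Pi.single 1 (a : ℤ) - Pi.single 1 (a' : ℤ) - Pi.single 0 (R : ℤ) := by abel
    have e2 : (x + Pi.single 1 (a : ℤ) - (x + Pi.single 0 (R : ℤ) + Pi.single 1 (a' : ℤ) + Pi.single 2 (R : ℤ)) : Site 4) =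
        Pi.single 1 (a : ℤ) - Pi.single 1 (a' : ℤ) - Pi.single 0 (R : ℤ) + (-1 : ℤ) • Pi.single 2 (R : ℤ) := by
      simp only [neg_smul, one_smul]; abel
    have e3 : (x + Pi.single 1 (a : ℤ) + Pi.single 2 (R : ℤ) - (x + Pi.single 0 (R : ℤ) + Pi.single 1 (a' : ℤ)) : Site 4) =
        Pi.single 1 (a : ℤ) - Pi.single 1 (a' : ℤ) - Pi.single 0 (R : ℤ) + (1 : ℤ) • Pi.single 2 (R : ℤ) := by
      simp only [one_smul]; abel
    have e4 : (x + Pi.single 1 (a : ℤ) + Pi.single 2 (R : ℤ) -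
        (x + Pi.single 0 (R : ℤ) + Pi.single 1 (a' : ℤ) + Pi.single 2 (R : ℤ)) : Site 4) =
        Pi.single 1 (a : ℤ) - Pi.single 1 (a' : ℤ) - Pi.single 0 (R : ℤ) := by abel
    rw [e1, e2, e3, e4]
    have ht0 : (0 : ℝ) ≤ ((a : ℝ) - a') ^ 2 := sq_nonneg _
    have htR := sq_sub_le_sq_of_mem_range ha ha'
    have hv := sum_sq_shape_one 1 (Or.inl rfl) a a' R
    have hm := hstep R hR _ _ _ ht0 htR hv (sum_sq_shape_two 1 2 (Or.inl ⟨rfl, rfl⟩) a a' R (-1) (Or.inr rfl))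
    have hp := hstep R hR _ _ _ ht0 htR hv (sum_sq_shape_two 1 2 (Or.inl ⟨rfl, rfl⟩) a a' R 1 (Or.inl rfl))
    linarith
  · rw [← hconst]
    refine sum_le_sum fun b hb => sum_le_sum fun b' hb' => ?_
    have e5 : (x + Pi.single 1 (R : ℤ) + Pi.single 2 (b : ℤ) -
        (x + Pi.single 0 (R : ℤ) + Pi.single 1 (R : ℤ) + Pi.single 2 (b' : ℤ)) : Site 4) =
        Pi.single 2 (b : ℤ) - Pi.single 2 (b' : ℤ) - Pi.single 0 (R : ℤ) := by abel
    have e6 : (x + Pi.single 1 (R : ℤ) + Pi.single 2 (b : ℤ) - (x + Pi.single 0 (R : ℤ) + Pi.single 2 (b' : ℤ)) : Site 4) =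
        Pi.single 2 (b : ℤ) - Pi.single 2 (b' : ℤ) - Pi.single 0 (R : ℤ) + (1 : ℤ) • Pi.single 1 (R : ℤ) := by
      simp only [one_smul]; abel
    have e7 : (x + Pi.single 2 (b : ℤ) - (x + Pi.single 0 (R : ℤ) + Pi.single 1 (R : ℤ) + Pi.single 2 (b' : ℤ)) : Site 4) =
        Pi.single 2 (b : ℤ) - Pi.single 2 (b' : ℤ) - Pi.single 0 (R : ℤ) + (-1 : ℤ) • Pi.single 1 (R : ℤ) := by
      simp only [neg_smul, one_smul]; abel
    have e8 : (x + Pi.single 2 (b : ℤ) - (x + Pi.single 0 (R : ℤ) + Pi.single 2 (b' : ℤ)) : Site 4) =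
        Pi.single 2 (b : ℤ) - Pi.single 2 (b' : ℤ) - Pi.single 0 (R : ℤ) := by abel
    rw [e5, e6, e7, e8]
    have ht0 : (0 : ℝ) ≤ ((b : ℝ) - b') ^ 2 := sq_nonneg _
    have htR := sq_sub_le_sq_of_mem_range hb hb'
    have hv := sum_sq_shape_one 2 (Or.inr rfl) b b' R
    have hp := hstep R hR _ _ _ ht0 htR hv (sum_sq_shape_two 2 1 (Or.inr ⟨rfl, rfl⟩) b b' R 1 (Or.inl rfl))
    have hm := hstep R hR _ _ _ ht0 htR hv (sum_sq_shape_two 2 1 (Or.inr ⟨rfl, rfl⟩) b b' R (-1) (Or.inr rfl))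
    linarith

/-- The time-zero cube has at least `R³` sites (it contains `{0} × [0, R)³`). -/
theorem pow_three_le_card_timeZeroCube (R : ℕ) : R ^ 3 ≤ (timeZeroCube R).card := by
  have hcard : ((range R ×ˢ range R) ×ˢ range R).card = R ^ 3 := by
    simp only [card_product, card_range]; ring
  rw [← hcard]
  refine Finset.card_le_card_of_injOn
    (fun abc : (ℕ × ℕ) × ℕ => (Pi.single 1 (abc.1.1 : ℤ) + Pi.single 2 (abc.1.2 : ℤ) + Pi.single 3 (abc.2 : ℤ) : Site 4))
    ?_ ?_
  · rintro ⟨⟨a, b⟩, c⟩ h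
    simp only [coe_product, Set.mem_prod, mem_coe, mem_range] at h
    obtain ⟨⟨ha, hb⟩, hc⟩ := h
    simp only [mem_coe, timeZeroCube, mem_filter, mem_box]
    refine ⟨fun i => ?_, by simp⟩
    fin_cases i <;> simp <;> omega
  · rintro ⟨⟨a, b⟩, c⟩ _ ⟨⟨a', b'⟩, c'⟩ _ h
    have h1 := congr_fun h 1
    have h2 := congr_fun h 2
    have h3 := congr_fun h 3
    simp at h1 h2 h3
    simp [h1, h2, h3]

/-- `|timeZeroCube R| ≥ R³`, cast to `ℝ`. -/
theorem pow_three_le_card_timeZeroCube_real (R : ℕ) : (R : ℝ) ^ 3 ≤ ((timeZeroCube R).card : ℝ) := by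
  exact_mod_cast pow_three_le_card_timeZeroCube R

/-- Bookkeeping: `m₀² · |timeZeroCube R| = Σ_{x ∈ timeZeroCube R} m₀²`. -/
theorem sq_mul_card_timeZeroCube (R : ℕ) (m₀ : ℝ) :
    m₀ ^ 2 * ((timeZeroCube R).card : ℝ) = ∑ _x ∈ timeZeroCube R, m₀ ^ 2 := by
  rw [sum_const, nsmul_eq_mul, mul_comm]

/-- One diagonal term is dominated by its row: `M(x, x + R e₀; R)² ≤ Σ_{x'} M(x, x' + R e₀; R)²` (all terms are squares). -/
theorem diag_sq_le_row_sum (R : ℕ) (x : Site 4) (hx : x ∈ timeZeroCube R) :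
    mutualInductance x (x + Pi.single 0 (R : ℤ)) R ^ 2 ≤
      ∑ x' ∈ timeZeroCube R, mutualInductance x (x' + Pi.single 0 (R : ℤ)) R ^ 2 := by
  have h := Finset.single_le_sum (s := timeZeroCube R)
    (f := fun x' : Site 4 => mutualInductance x (x' + Pi.single 0 (R : ℤ)) R ^ 2) (fun _ _ => sq_nonneg _) hx
  exact h

/-- The diagonal (time-coaxial) part of the Wick sum: `Σ_x M(x, x + R e₀; R)² ≤ wickLagSum R R`. -/
theorem sum_diag_sq_le_wickLagSum (R : ℕ) :
    ∑ x ∈ timeZeroCube R, mutualInductance x (x + Pi.single 0 (R : ℤ)) R ^ 2 ≤ wickLagSum R R := by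
  unfold wickLagSum
  exact sum_le_sum fun x hx => diag_sq_le_row_sum R x hx

/-- A uniform floor `m₀ ≤ M(x, x + R e₀; R)` with `m₀ > 0` gives `Σ_x m₀² ≤ Σ_x M(x, x + R e₀; R)²`. -/
theorem sum_sq_floor_le_sum_diag_sq (m₀ : ℝ) (hm₀ : 0 < m₀) (R : ℕ)
    (hM : ∀ x : Site 4, m₀ ≤ mutualInductance x (x + Pi.single 0 (R : ℤ)) R) :
    ∑ _x ∈ timeZeroCube R, m₀ ^ 2 ≤ ∑ x ∈ timeZeroCube R, mutualInductance x (x + Pi.single 0 (R : ℤ)) R ^ 2 :=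
  sum_le_sum fun x _ => pow_le_pow_left₀ hm₀.le (hM x) 2

/-- **Registered stub S1 `stub_gaussCore` of crux `stmt-QuantumFields-22503` (T′ `ColdBoxSoftLoopLagFloor`, route `SoftLoopLongLag`),
line `birth`, BY NAME + SIGNATURE** — the Wick floor of the free lattice-Maxwell model on `ℤ⁴`: there are `c > 0` and `R₀` with
`c·R³ ≤ wickLagSum R R` for all `R ≥ R₀`.  Proof: drop the off-diagonal pairs (squares), bound each of the `≥ R³` diagonal terms
`M(x, x + R e₀; R)²` below by `m₀²` (`mutualInductance_diag_lower`); `c = m₀²`.  `G`-free, `β`-free; RECORD-label rung R2xi-G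
support, not the Clay gap. -/
theorem stub_gaussCore : ∃ c : ℝ, 0 < c ∧ ∃ R₀ : ℕ, ∀ R : ℕ, R₀ ≤ R → c * (R : ℝ) ^ 3 ≤ wickLagSum R R := by
  obtain ⟨m₀, hm₀, R₀, -, hM⟩ := mutualInductance_diag_lower
  refine ⟨m₀ ^ 2, by positivity, R₀, fun R hR => ?_⟩
  have h1 : m₀ ^ 2 * (R : ℝ) ^ 3 ≤ m₀ ^ 2 * ((timeZeroCube R).card : ℝ) :=
    mul_le_mul_of_nonneg_left (pow_three_le_card_timeZeroCube_real R) (by positivity)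
  exact ((h1.trans_eq (sq_mul_card_timeZeroCube R m₀)).trans
    (sum_sq_floor_le_sum_diag_sq m₀ hm₀ R (hM R hR))).trans (sum_diag_sq_le_wickLagSum R)

end Summit.QuantumFields.YangMills.Theorems.SoftLoopLongLag

end
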